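import Summits.CriticalPhenomena.CardyFormulaZ2.Theorems.CardyFlipRussoCoveringLegUniversality
import Summits.CriticalPhenomena.CardyFormulaZ2.Theorems.CardyFlipRussoCoveringLegStubRussoQDerivative
import Summits.CriticalPhenomena.CardyFormulaZ2.Theses.UnionJackBeffara
import Literature.Probability.Percolation.UnionJack
import HarnessLib

/-!
# The one open stub of `CardyFlipRusso.CoveringLeg` and its EXISTING twins in routes CardySectorGap and
UnionJackBeffara (line `five-arm-null`, lead c4, cycle 5)

Route `CardyFlipRusso`, sub-problem `CriticalPhenomena/CardyFormulaZ2`, crux item stmt-CriticalPhenomena-6435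
(`Summit.CriticalPhenomena.CardyFormulaZ2.Theses.CardyFlipRusso.CoveringLeg` = `SiteCardy → BondCardy`).  Skeleton v4
of the line is closed modulo ONE registered stub, `Sig.stub_mixedInterpolationShift := MixedInterpolationShift`
(`P_{1/2}[cross] − P_0[cross] → 0` along the shifted family `R ⊕ δ·i/√2` in the covering-adapted frame B), which is
EXACTLY frame-free site-`G_s`/bond-`ℤ²` crossing universality (`mixedInterpolationShift_iff_universality`, p122660) and,
under the crux hypothesis, EQUIVALENT to the crux (`coveringLeg_iff_universality_of_siteCardy`, p123912).

Two other OPEN routes of this sub-problem already carry Beffara's "leg II" (flatness of the mixed interpolation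
`P_{1/2,q}`, `q : ½ → 0`) as items of their own.  This file records IN THE TREE exactly how the stub relates to them,
so that the crux can be parked on an EXISTING item with a kernel-checked statement of the residual:

* **Twin 1 — `CardySectorGap.MixedInterpolation` (stmt-CriticalPhenomena-7050)**, frame B, UNshifted rectangles.
  - `mixedInterpolation_of_vertexFacePivotalBalance`: inside CardySectorGap it follows from that route's crux
    `VertexFacePivotalBalance` (stmt-7049, Beffara's eq. (5.1)) by the LANDED Russo step `stub_russoQDerivative`
    (p116769 = stmt-10401);
  - `coveringLeg_of_cardyCentredSquare_of_mixedInterpolation`: `CoveringLeg ⟸ stmt-7048 ∧ stmt-7050` with the crux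
    hypothesis idle (Kesten covering bridge stmt-7055, landed p122240);
  - `lawP_zero_crossS_translate_sub_tendsto`: the BOND-side one-mesh translation null is a theorem (Schramm–Smirnov
    crude-crossing continuity for bond-`ℤ²`, through `coverShift_tendsto_sub`);
  - `stub_iff_mixedInterpolation_of_siteTranslationNull`: **modulo the SITE-side one-mesh translation null `T`**
    (`P_{1/2}[cross (R ⊕ δ·i/√2, δ)] − P_{1/2}[cross (R, δ)] → 0`: crude site-`G_s` crossing probabilities at `½` do
    not feel a half-diagonal translation of the domain — an RSW-grade boundary statement about site percolation on
    `G_s`, absent from the tree, taken here as an explicit hypothesis) **the stub IS stmt-7050**, hence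
    `coveringLeg_of_mixedInterpolation_of_siteTranslationNull` and, under `SiteCardy`,
    `coveringLeg_iff_mixedInterpolation_of_siteCardy : CoveringLeg ↔ stmt-7050`.
* **Twin 2 — `UnionJackBeffara.MixedInterpolation` (stmt-CriticalPhenomena-4559)**, the route realising card
  z4-protected-beffara-union-jack to whose "leg II" the crux's thesis delegates.  Its frame (`unionJackEmbed`,
  `unionJackGraph` of `Literature/Probability/Percolation/UnionJack.lean`) is frame B SCALED by `1/√2`
  (`unionJackGraph_eq_gsGraph`, `unionJackEmbed_eq_zS_div_sqrt_two`), so at mesh `√2·δ` its crude event is the frame-B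
  event at mesh `δ` with the WIDER slack `2√2·δ` (`ujCrossingProb_sqrt_two_mul`); reading the limit at mesh `√2·δ`
  changes nothing (`tendsto_comp_const_mul_iff`), whence `unionJackBeffara_mixedInterpolation_iff`: **stmt-4559 is
  stmt-7050 with crude slack `2√2·δ` in place of `2δ`** — not the same item verbatim.  Modulo the corresponding
  site-side null (wide slack at `q = ½` versus the frame-A crossing of `ρ⁻¹R`) and a wide-slack covering bridge on
  the bond side (both explicit hypotheses), the stub IS stmt-4559 (`stub_iff_unionJackBeffara_of_nulls`,
  `coveringLeg_of_unionJackBeffara_of_nulls`).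

Nothing is asserted unconditionally about percolation beyond what the tree proves; no new definitions.

References: V. Beffara, *Is critical 2D percolation universal?*, Progr. Probab. 60 (2008) §5.1–5.2, Prop. 18
[Beffara2008Universal]; H. Kesten, *Percolation theory for mathematicians* (1982) §3.4 [Kesten1982]; O. Schramm,
S. Smirnov, Ann. Probab. 39 (2011) Lemma 5.1 [SchrammSmirnov2011].
-/

noncomputable section

namespace Summit.CriticalPhenomena.CardyFormulaZ2.Cruxes.CoveringLeg.FiveArmNull

open Filter Set Topology
open Literature.Probability.RandomPlanarGeometry Literature.Probability.Percolation
open Literature.Probability.LatticeModels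
open Literature.Barriers.CriticalPhenomena (MixedSite mixedParam)
open Summit.CriticalPhenomena.CardyFormulaZ2.Theses

/-! ### Twin 1: `CardySectorGap.MixedInterpolation` (stmt-CriticalPhenomena-7050) -/

/-- Inside route CardySectorGap, `MixedInterpolation` (stmt-7050) follows from that route's crux
`VertexFacePivotalBalance` (stmt-7049, Beffara's eq. (5.1)) by the landed Russo step (stmt-10401, p116769).
[cite: Beffara2008Universal, §5.2 Prop. 18] -/
theorem mixedInterpolation_of_vertexFacePivotalBalance (hV : CardySectorGap.VertexFacePivotalBalance) :
    CardySectorGap.MixedInterpolation :=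
  russoQDerivative_iff.1 stub_russoQDerivative hV

/-- **`CoveringLeg` ⟸ stmt-7048 ∧ stmt-7050** (CONDITIONAL; the crux hypothesis is idle): Cardy at `q = ½` in
frame B plus flatness of the interpolation give Cardy at `q = 0` (`mixedCardyZero_of`), and Kesten's covering bridge
(CardySectorGap's stmt-7055, PROVED: `coveringBridge_proof`) gives crude bond-`ℤ²` Cardy. [cite: Kesten1982, §3.4] -/
theorem coveringLeg_of_cardyCentredSquare_of_mixedInterpolation (hC : CardySectorGap.CardyCentredSquare)
    (hM : CardySectorGap.MixedInterpolation) : CardyFlipRusso.CoveringLeg :=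
  coveringLeg_iff.2 fun _ => coveringBridge_iff.1 coveringBridge_proof (mixedCardyZero_of hC hM)

/-- **Bond-side one-mesh translation null (PROVED).** At `q = 0` (Kesten's encoding of bond-`ℤ²`) the frame-B crude
crossing probabilities of `R ⊕ δ·w` and of `R` differ by `o(1)` for every fixed `w`: both differ by `o(1)` from the
crude bond-`ℤ²` crossing probability of `R` (`coverShift_tendsto_sub`, whose analytic input is the tree's
Schramm–Smirnov crude-crossing continuity). [cite: SchrammSmirnov2011, Lemma 5.1] -/
theorem lawP_zero_crossS_translate_sub_tendsto (R : ConformalRectangle) (w : ℂ) :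
    Tendsto (fun δ : ℝ =>
      (lawP 0).real (crossS (R.map (similarity 1 one_ne_zero ((δ : ℂ) * w))) δ) -
        (lawP 0).real (crossS R δ)) (𝓝[>] 0) (𝓝 0) := by
  have h1 := coverShift_tendsto_sub cover_lowerCrossing_subset_crossS_shift R w
  have h0 := coverShift_tendsto_sub cover_lowerCrossing_subset_crossS_shift R 0
  have h := h1.sub h0
  rw [sub_zero] at h
  refine h.congr' (Eventually.of_forall fun δ => ?_)
  simp only [mul_zero, map_similarity_one_zero]
  ring

/-- **The stub IS stmt-7050 modulo the site-side one-mesh translation null.**  Hypothesis `hT` (NOT in the tree;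
an RSW-grade boundary statement about critical site percolation on `G_s`): at `q = ½` the frame-B crude crossing
probabilities of `R ⊕ δ·i/√2` and of `R` differ by `o(1)`.  Then `P_{1/2} − P_0 → 0` along the shifted family
(the stub) iff along the unshifted one (stmt-7050), the bond side being `lawP_zero_crossS_translate_sub_tendsto`.
[cite: Beffara2008Universal, §5.2] -/
theorem stub_iff_mixedInterpolation_of_siteTranslationNull
    (hT : ∀ R : ConformalRectangle, Tendsto (fun δ : ℝ =>
      (lawP half).real (crossS (R.map (similarity 1 one_ne_zero ((δ : ℂ) * (Complex.I / (Real.sqrt 2 : ℂ))))) δ) -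
        (lawP half).real (crossS R δ)) (𝓝[>] 0) (𝓝 0)) :
    Sig.stub_mixedInterpolationShift ↔ CardySectorGap.MixedInterpolation := by
  rw [stub_mixedInterpolationShift_iff, mixedInterpolation_iff]
  unfold MixedInterpolationShift
  refine forall_congr' fun R => ?_
  have hD := (hT R).sub (lawP_zero_crossS_translate_sub_tendsto R (Complex.I / (Real.sqrt 2 : ℂ)))
  rw [sub_zero] at hD
  constructor
  · intro h
    have h' := h.sub hD
    rw [sub_zero] at h'
    refine h'.congr' (Eventually.of_forall fun δ => ?_)
    ring
  · intro h
    have h' := h.add hD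
    rw [add_zero] at h'
    refine h'.congr' (Eventually.of_forall fun δ => ?_)
    ring

/-- **`CoveringLeg` ⟸ stmt-7050 modulo the site-side translation null** (CONDITIONAL proof of the crux by name).
[cite: Beffara2008Universal, §5.1–5.2] -/
theorem coveringLeg_of_mixedInterpolation_of_siteTranslationNull
    (hT : ∀ R : ConformalRectangle, Tendsto (fun δ : ℝ =>
      (lawP half).real (crossS (R.map (similarity 1 one_ne_zero ((δ : ℂ) * (Complex.I / (Real.sqrt 2 : ℂ))))) δ) -
        (lawP half).real (crossS R δ)) (𝓝[>] 0) (𝓝 0))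
    (hM : CardySectorGap.MixedInterpolation) : CardyFlipRusso.CoveringLeg :=
  coveringLeg_of_mixedInterpolationShift ((stub_iff_mixedInterpolation_of_siteTranslationNull hT).2 hM)

/-- **Under the crux hypothesis and modulo the site-side translation null, `CoveringLeg` ⟺ stmt-7050**
(calibration against the existing twin). [cite: Beffara2008Universal, §5.1–5.2] -/
theorem coveringLeg_iff_mixedInterpolation_of_siteCardy : (∀ R : Literature.Probability.RandomPlanarGeometry.ConformalRectangle, Filter.Tendsto (fun δ : ℝ => (Summit.CriticalPhenomena.CardyFormulaZ2.Cruxes.CoveringLeg.FiveArmNull.lawP Literature.Probability.Percolation.half).real (Summit.CriticalPhenomena.CardyFormulaZ2.Cruxes.CoveringLeg.FiveArmNull.crossS (R.map (Literature.Probability.RandomPlanarGeometry.similarity 1 one_ne_zero ((δ : ℂ) * (Complex.I / (Real.sqrt 2 : ℂ))))) δ) - (Summit.CriticalPhenomena.CardyFormulaZ2.Cruxes.CoveringLeg.FiveArmNull.lawP Literature.Probability.Percolation.half).real (Summit.CriticalPhenomena.CardyFormulaZ2.Cruxes.CoveringLeg.FiveArmNull.crossS R δ)) (nhdsWithin 0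 (Set.Ioi 0)) (nhds 0)) → Summit.CriticalPhenomena.CardyFormulaZ2.Cruxes.CoveringLeg.FiveArmNull.SiteCardy → (Summit.CriticalPhenomena.CardyFormulaZ2.Theses.CardyFlipRusso.CoveringLeg ↔ Summit.CriticalPhenomena.CardyFormulaZ2.Theses.CardySectorGap.MixedInterpolation) :=
  fun hT hS => (coveringLeg_iff_universality_of_siteCardy hS).trans
    (mixedInterpolationShift_iff_universality.symm.trans (stub_iff_mixedInterpolation_of_siteTranslationNull hT))

/-! ### Twin 2: `UnionJackBeffara.MixedInterpolation` (stmt-CriticalPhenomena-4559) -/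

/-- The Union-Jack route's graph IS frame B's graph (both are the tree's `centredSquareGraph`). [cite: Beffara2008Universal, §5.1] -/
theorem unionJackGraph_eq_gsGraph : unionJackGraph = gsGraph := by
  rw [gsGraph_eq]
  rfl

/-- **The Union-Jack frame is frame B scaled by `1/√2`**: `unionJackEmbed = zS / √2` (type-I spacing `1/√2`,
bond lattice `ℤ[i]`; frame B has type-I spacing `1`, bond lattice `√2·ℤ[i] = squareLatticeEmbedding.z`).
[cite: Beffara2008Universal, §5.1] -/
theorem unionJackEmbed_eq_zS_div_sqrt_two (v : MixedSite) :
    unionJackEmbed v = zS v / ((Real.sqrt 2 : ℝ) : ℂ) := by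
  have hs : ((Real.sqrt 2 : ℝ) : ℂ) * ((Real.sqrt 2 : ℝ) : ℂ) = 2 := by
    rw [← Complex.ofReal_mul, Real.mul_self_sqrt zero_le_two]
    norm_num
  rcases v with x | f
  · rw [unionJackEmbed_inl, zS, Sum.elim_inl, div_div, hs]
  · rw [unionJackEmbed_inr, zS, Sum.elim_inr, div_div, hs]
    congr 1
    push_cast
    ring

/-- At mesh `√2·δ` the Union-Jack sites sit exactly where the frame-B sites sit at mesh `δ`. [folklore] -/
theorem sqrt_two_mul_mul_unionJackEmbed (δ : ℝ) (v : MixedSite) :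
    ((Real.sqrt 2 * δ : ℝ) : ℂ) * unionJackEmbed v = (δ : ℂ) * zS v := by
  have hs : ((Real.sqrt 2 : ℝ) : ℂ) ≠ 0 := Complex.ofReal_ne_zero.2 (Real.sqrt_pos.2 two_pos).ne'
  rw [unionJackEmbed_eq_zS_div_sqrt_two, Complex.ofReal_mul]
  field_simp

/-- **The Union-Jack crude crossing probability at mesh `√2·δ` is the frame-B crude crossing probability at mesh `δ`
with slack `2√2·δ`** (instead of frame B's `2δ`): same law `P_{1/2,q}`, same graph, same site positions, wider
endpoint collars. [cite: Beffara2008Universal, §5.1] -/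
theorem ujCrossingProb_sqrt_two_mul (q : unitInterval) (R : ConformalRectangle) (δ : ℝ) :
    ujCrossingProb q R (Real.sqrt 2 * δ) = (lawP q).real {ω | ∃ u v,
      Metric.infDist ((δ : ℂ) * zS u) (R.arc 0) ≤ 2 * Real.sqrt 2 * δ ∧
        Metric.infDist ((δ : ℂ) * zS v) (R.arc 2) ≤ 2 * Real.sqrt 2 * δ ∧
        ω ∈ siteConnIn gsGraph {y | (δ : ℂ) * zS y ∈ R.carrier} u v} := by
  have hsl : 2 * (Real.sqrt 2 * δ) = 2 * Real.sqrt 2 * δ := by ring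
  rw [ujCrossingProb_eq, unionJackGraph_eq_gsGraph]
  simp only [sqrt_two_mul_mul_unionJackEmbed, hsl]
  rfl

/-- **Change of mesh variable**: a statement "as `δ → 0⁺`" may be read at mesh `a·δ` (`a > 0`), since
`δ ↦ a·δ` and `δ ↦ a⁻¹·δ` both map `δ → 0⁺` to `δ → 0⁺`. [folklore] -/
theorem tendsto_comp_const_mul_iff {α : Type*} {l : Filter α} {f : ℝ → α} {a : ℝ} (ha : 0 < a) :
    Tendsto (fun δ : ℝ => f (a * δ)) (𝓝[>] 0) l ↔ Tendsto f (𝓝[>] 0) l := by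
  have aux : ∀ {b : ℝ}, 0 < b → Tendsto (fun δ : ℝ => b * δ) (𝓝[>] 0) (𝓝[>] 0) := fun {b} hb => by
    refine tendsto_nhdsWithin_of_tendsto_nhds_of_eventually_within _ ?_ ?_
    · have h : Tendsto (fun δ : ℝ => b * δ) (𝓝 0) (𝓝 (b * 0)) := (continuous_const_mul b).tendsto 0
      rw [mul_zero] at h
      exact h.mono_left nhdsWithin_le_nhds
    · exact eventually_mem_nhdsWithin.mono fun δ hδ => mul_pos hb hδ
  constructor
  · intro h
    have h' := h.comp (aux (inv_pos.2 ha))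
    refine h'.congr fun δ => ?_
    simp only [Function.comp_apply, mul_inv_cancel_left₀ ha.ne']
  · intro h
    exact h.comp (aux ha)

/-- `UnionJackBeffara.MixedInterpolation` re-signed over the Literature name `ujCrossingProb` (by `rfl`). [cite: Beffara2008Universal, §5.2] -/
theorem unionJackBeffara_mixedInterpolation_iff_ujCrossingProb :
    UnionJackBeffara.MixedInterpolation ↔ ∀ R : ConformalRectangle,
      Tendsto (fun δ : ℝ => ujCrossingProb half R δ - ujCrossingProb 0 R δ) (𝓝[>] 0) (𝓝 0) :=
  Iff.rfl

/-- **stmt-4559 is stmt-7050 at crude slack `2√2·δ`** (exact): `UnionJackBeffara.MixedInterpolation` holds iff for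
every conformal rectangle the frame-B crude crossing probabilities WITH SLACK `2√2·δ` satisfy
`P_{1/2} − P_0 → 0` — compare `mixedInterpolation_iff` (stmt-7050: the same with slack `2δ`) and the stub (slack `2δ`,
shifted family).  Read the Union-Jack statement at mesh `√2·δ` (`tendsto_comp_const_mul_iff`) and unfold
(`ujCrossingProb_sqrt_two_mul`). [cite: Beffara2008Universal, §5.1–5.2] -/
theorem unionJackBeffara_mixedInterpolation_iff :
    UnionJackBeffara.MixedInterpolation ↔ ∀ R : ConformalRectangle, Tendsto (fun δ : ℝ =>
      (lawP half).real {ω | ∃ u v,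
          Metric.infDist ((δ : ℂ) * zS u) (R.arc 0) ≤ 2 * Real.sqrt 2 * δ ∧
            Metric.infDist ((δ : ℂ) * zS v) (R.arc 2) ≤ 2 * Real.sqrt 2 * δ ∧
            ω ∈ siteConnIn gsGraph {y | (δ : ℂ) * zS y ∈ R.carrier} u v} -
        (lawP 0).real {ω | ∃ u v,
          Metric.infDist ((δ : ℂ) * zS u) (R.arc 0) ≤ 2 * Real.sqrt 2 * δ ∧
            Metric.infDist ((δ : ℂ) * zS v) (R.arc 2) ≤ 2 * Real.sqrt 2 * δ ∧
            ω ∈ siteConnIn gsGraph {y | (δ : ℂ) * zS y ∈ R.carrier} u v}) (𝓝[>] 0) (𝓝 0) := by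
  rw [unionJackBeffara_mixedInterpolation_iff_ujCrossingProb]
  refine forall_congr' fun R => ?_
  rw [← tendsto_comp_const_mul_iff (f := fun δ : ℝ => ujCrossingProb half R δ - ujCrossingProb 0 R δ)
    (Real.sqrt_pos.2 two_pos)]
  simp only [ujCrossingProb_sqrt_two_mul]

/-- Likewise for the first conjunct of `UnionJackBeffara.Target` (Cardy for crude `P_{1/2,1/2}` crossings in the
Union-Jack frame): it is Cardy for the frame-B crude site crossing probabilities WITH SLACK `2√2·δ` — compare
`cardyCentredSquare_iff` (stmt-7048: slack `2δ`) and `SiteCardy` (frame A, slack `2δ`). [cite: Beffara2008Universal, §5.1] -/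
theorem unionJackBeffara_cardy_iff :
    (∀ R : ConformalRectangle, R.HasCrossingLimit (ujCrossingProb half R) cardyFunction) ↔
      ∀ R : ConformalRectangle, R.HasCrossingLimit (fun δ : ℝ => (lawP half).real {ω | ∃ u v,
          Metric.infDist ((δ : ℂ) * zS u) (R.arc 0) ≤ 2 * Real.sqrt 2 * δ ∧
            Metric.infDist ((δ : ℂ) * zS v) (R.arc 2) ≤ 2 * Real.sqrt 2 * δ ∧
            ω ∈ siteConnIn gsGraph {y | (δ : ℂ) * zS y ∈ R.carrier} u v}) cardyFunction := by
  refine forall_congr' fun R => forall_congr' fun φ => forall_congr' fun x => forall_congr' fun _ => ?_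
  rw [← tendsto_comp_const_mul_iff (f := ujCrossingProb half R) (Real.sqrt_pos.2 two_pos)]
  simp only [ujCrossingProb_sqrt_two_mul]

/-- **The stub IS stmt-4559 modulo two discretisation nulls** (both explicit hypotheses): `hT'`, SITE side (NOT in the
tree, RSW-grade): at `q = ½` the Union-Jack crude crossing probability of `R` at mesh `√2·δ` (frame B, slack `2√2·δ`)
and the frame-A crude site-`G_s` crossing probability of `ρ⁻¹R` at mesh `δ` (slack `2δ`; `= P_{1/2}` of the shifted
family, `shift_lawP_half_crossS`) differ by `o(1)`; `hB'`, BOND side (provable like `coverShift_tendsto_sub`, with a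
wider collar; not done here): at `q = 0` the Union-Jack crude crossing probability at mesh `√2·δ` and the crude
bond-`ℤ²` crossing probability `bondProb R δ` differ by `o(1)`. [cite: Beffara2008Universal, §5.1–5.2] -/
theorem stub_iff_unionJackBeffara_of_nulls : (∀ R : Literature.Probability.RandomPlanarGeometry.ConformalRectangle, Filter.Tendsto (fun δ : ℝ => Literature.Probability.Percolation.ujCrossingProb Literature.Probability.Percolation.half R (Real.sqrt 2 * δ) - Summit.CriticalPhenomena.CardyFormulaZ2.Cruxes.CoveringLeg.FiveArmNull.siteProb (R.map (Literature.Probability.RandomPlanarGeometry.similarity ((1 + Complex.I) / (Real.sqrt 2 : ℂ)) Summit.CriticalPhenomena.CardyFormulaZ2.Cruxes.CoveringLeg.FiveArmNull.frame_rotInv_ne_zero 0)) δ) (nhdsWithin 0 (Set.Ioi 0)) (nhds 0)) → (∀ R : Literature.Probability.RandomPlanarGeometry.ConformalRectangle, Filter.Tendsto (fun δ : ℝ => Literature.Probability.Percolation.ujCrossingProb 0 R (Real.sqrt 2 * δ) - Summit.CriticalPhenomena.CardyFormulaZ2.Cruxes.CoveringLeg.FiveArmNull.bondProb R δ) (nhdsWithin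 0 (Set.Ioi 0)) (nhds 0)) → (Summit.CriticalPhenomena.CardyFormulaZ2.Cruxes.CoveringLeg.FiveArmNull.Sig.stub_mixedInterpolationShift ↔ Summit.CriticalPhenomena.CardyFormulaZ2.Theses.UnionJackBeffara.MixedInterpolation) := by
  intro hT' hB'
  rw [stub_mixedInterpolationShift_iff, mixedInterpolationShift_iff_universality,
    unionJackBeffara_mixedInterpolation_iff_ujCrossingProb]
  refine forall_congr' fun R => ?_
  rw [← tendsto_comp_const_mul_iff (f := fun δ : ℝ => ujCrossingProb half R δ - ujCrossingProb 0 R δ)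
    (Real.sqrt_pos.2 two_pos)]
  have hD := (hT' R).sub (hB' R)
  rw [sub_zero] at hD
  constructor
  · intro h
    have h' := h.add hD
    rw [add_zero] at h'
    refine h'.congr' (Eventually.of_forall fun δ => ?_)
    ring
  · intro h
    have h' := h.sub hD
    rw [sub_zero] at h'
    refine h'.congr' (Eventually.of_forall fun δ => ?_)
    ring

/-- **`CoveringLeg` ⟸ stmt-4559 modulo the two discretisation nulls** (CONDITIONAL proof of the crux by name; this is
the delegation "leg II of card z4-protected-beffara-union-jack" of the crux's thesis, made precise).
[cite: Beffara2008Universal, §5.1–5.2] -/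
theorem coveringLeg_of_unionJackBeffara_of_nulls
    (hT' : ∀ R : ConformalRectangle, Tendsto (fun δ : ℝ => ujCrossingProb half R (Real.sqrt 2 * δ) -
      siteProb (R.map (similarity ((1 + Complex.I) / (Real.sqrt 2 : ℂ)) frame_rotInv_ne_zero 0)) δ)
      (𝓝[>] 0) (𝓝 0))
    (hB' : ∀ R : ConformalRectangle, Tendsto (fun δ : ℝ => ujCrossingProb 0 R (Real.sqrt 2 * δ) - bondProb R δ)
      (𝓝[>] 0) (𝓝 0))
    (hM : UnionJackBeffara.MixedInterpolation) : CardyFlipRusso.CoveringLeg :=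
  coveringLeg_of_mixedInterpolationShift ((stub_iff_unionJackBeffara_of_nulls hT' hB').2 hM)

end Summit.CriticalPhenomena.CardyFormulaZ2.Cruxes.CoveringLeg.FiveArmNull

end
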